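import Summits.QuantumFields.YangMills.Theorems.IsotropyFromPowerCountingTemperedCurvatureMomentsDegreeTwo

/-!
# Three-point kernel of `TemperedCurvatureMoments`, part 1: patching local kernels on `(ℝ⁴)³`

Support file for stub `stub_threePointKernel` of reshape 4 of
`Cruxes/TemperedCurvatureMoments/Lines/Sketch.lean` (crux stmt-QuantumFields-17721, line `Sketch`).
Pure analysis on `(ℝ⁴)³`, the three-slot copies of the two-slot patching lemmas of
`PencilRigidityCurvatureKernelBoundKernelOffDiagonalPatch`:

* `integral_rep_of_local₃`: local representations of a continuous functional on `𝓢((ℝ⁴)³)` by a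
  kernel continuous on an open set `Ω` patch to a representation on all compactly supported test
  functions supported in `Ω` (smooth partition of unity);
* `exists_kernel_of_local₃`: continuous local kernels near every injective configuration (each on a
  box of balls inside the injective locus) glue to ONE kernel continuous on the injective locus
  (continuous local kernels of the same functional agree on overlaps), with the pointwise bound of the
  local kernel at its own centre;
* bookkeeping on tensors `⊗ᵢ fᵢ` with factors supported in disjoint balls (they lie in `⁰𝒮`) and on
  moving one slot of a three-slot family to the last position.

References: Osterwalder–Schrader, Comm. Math. Phys. 31 (1973) §2 (`⁰𝒮`); Hörmander, ALPDO I, Thm. 1.2.5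
(du Bois-Reymond), §2.2 (localization). [folklore]
-/

noncomputable section

namespace Summit.QuantumFields.YangMills.Theorems.TemperedCurvatureMoments.Sketch

open scoped BigOperators SchwartzMap Manifold ContDiff
open MeasureTheory Filter Topology Set Metric
open Literature.MathematicalPhysics.QuantumFieldTheory Literature.MathematicalPhysics.QuantumLattice
open Literature.MathematicalPhysics.AQFT
open Summit.QuantumFields.YangMills.Theorems.NPointIsotropy.Negative (E4)

namespace ThreePointKernel

/-! ## Open sets of configurations -/

/-- A box of balls `∏ᵢ B(xᵢ, r)` in `(ℝ⁴)³` is open. [folklore] -/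
theorem isOpen_box (x : Fin 3 → E4) (r : ℝ) : IsOpen {y : Fin 3 → E4 | ∀ i, y i ∈ ball (x i) r} := by
  rw [setOf_forall]
  exact isOpen_iInter_of_finite fun i => isOpen_ball.preimage (continuous_apply i)

/-- The injective locus `{y | y injective}` of `(ℝ⁴)³` is the complement of the coincidence locus. [folklore] -/
theorem setOf_injective_eq_compl : {y : Fin 3 → E4 | Function.Injective y} = (coincidenceLocus 3 E4)ᶜ := by
  ext y
  simp only [mem_setOf_eq, mem_compl_iff, mem_coincidenceLocus, not_exists, not_and]
  exact ⟨fun hy i j hij h => hij (hy h), fun hy i j h => by_contra fun hij => hy i j hij h⟩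

/-- The injective locus of `(ℝ⁴)³` is open. [folklore] -/
theorem isOpen_setOf_injective : IsOpen {y : Fin 3 → E4 | Function.Injective y} := by
  rw [setOf_injective_eq_compl]
  exact (isClosed_coincidenceLocus 3 E4).isOpen_compl

/-- A test function supported in the injective locus lies in `⁰𝒮₃`. [folklore] -/
theorem isOffDiagonal_of_tsupport_subset_injective {F : 𝓢((Fin 3 → E4), ℂ)}
    (h : tsupport (F : (Fin 3 → E4) → ℂ) ⊆ {y | Function.Injective y}) : IsOffDiagonal F :=
  IsOffDiagonal.of_tsupport_subset (by rwa [setOf_injective_eq_compl] at h)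

/-- Points of a small box around a separated configuration are injective: if `2r ≤ dist (xᵢ, xⱼ)` for
`i ≠ j` (with `r > 0`) then every `y ∈ ∏ B(xᵢ, r)` is injective. [folklore] -/
theorem injective_of_mem_box {x : Fin 3 → E4} {r : ℝ}
    (hsep : ∀ i j, i ≠ j → 2 * r ≤ dist (x i) (x j)) {y : Fin 3 → E4} (hy : ∀ i, y i ∈ ball (x i) r) :
    Function.Injective y := by
  intro i j hij
  by_contra hne
  have h := hsep i j hne
  have hi := hy i
  have hj := hy j
  rw [mem_ball] at hi hj
  have : dist (x i) (x j) ≤ dist (y i) (x i) + dist (y j) (x j) := by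
    calc dist (x i) (x j) ≤ dist (x i) (y i) + dist (y i) (x j) := dist_triangle _ _ _
      _ = dist (y i) (x i) + dist (y j) (x j) := by rw [dist_comm (x i) (y i), hij]
  linarith

/-! ## Patching local representations by a smooth partition of unity -/

/-- **Patching local representations (three slots).** Let `T` be a continuous functional on
`𝓢((ℝ⁴)³, ℂ)`, `κ` continuous on an open set `Ω`, and suppose every point of `Ω` has a neighbourhood
`O ⊆ Ω` on whose compactly supported test functions `T` is integration against `κ`. Then `T F = ∫ κ F`
for every compactly supported `F` with `supp F ⊆ Ω` (smooth partition of unity subordinate to a finite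
subcover of `supp F`). [folklore] -/
theorem integral_rep_of_local₃
    (T : 𝓢((Fin 3 → E4), ℂ) →L[ℂ] ℂ)
    {Ω : Set (Fin 3 → E4)} (hΩ : IsOpen Ω)
    (κ : (Fin 3 → E4) → ℂ) (hκ : ContinuousOn κ Ω)
    (hloc : ∀ z ∈ Ω, ∃ O : Set (Fin 3 → E4), IsOpen O ∧ z ∈ O ∧ O ⊆ Ω ∧
      ∀ F : 𝓢((Fin 3 → E4), ℂ), tsupport (F : (Fin 3 → E4) → ℂ) ⊆ O →
        HasCompactSupport (F : (Fin 3 → E4) → ℂ) → T F = ∫ x, κ x * F x)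
    (F : 𝓢((Fin 3 → E4), ℂ)) (hFc : HasCompactSupport (F : (Fin 3 → E4) → ℂ))
    (hF : tsupport (F : (Fin 3 → E4) → ℂ) ⊆ Ω) :
    Integrable (fun x => κ x * F x) ∧ T F = ∫ x, κ x * F x := by
  -- adapted from `CurvatureKernel.integral_rep_of_local` (…KernelOffDiagonalPatch), `Fin 2 → Fin 3`
  have hint : ∀ G : 𝓢((Fin 3 → E4), ℂ), HasCompactSupport (G : (Fin 3 → E4) → ℂ) →
      tsupport (G : (Fin 3 → E4) → ℂ) ⊆ Ω → Integrable (fun x => κ x * G x) :=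
    fun G hGc hG => (Literature.Analysis.Complex.continuous_mul_of_continuousOn_of_tsupport_subset hΩ hκ
      G.continuous hG).integrable_of_hasCompactSupport hGc.mul_left
  refine ⟨hint F hFc hF, ?_⟩
  choose O hOopen hzO hOΩ hOrep using hloc
  obtain ⟨t, ht⟩ := hFc.elim_finite_subcover (fun z : Ω => O z z.2) (fun z => hOopen z z.2)
    (fun x hx => mem_iUnion.2 ⟨⟨x, hF hx⟩, hzO x (hF hx)⟩)
  have hsub : tsupport (F : (Fin 3 → E4) → ℂ) ⊆ ⋃ i : {z // z ∈ t}, O i.1 i.1.2 := by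
    intro x hx
    obtain ⟨i, hi, hxi⟩ := mem_iUnion₂.1 (ht hx)
    exact mem_iUnion.2 ⟨⟨i, hi⟩, hxi⟩
  obtain ⟨φ, hφ⟩ := SmoothPartitionOfUnity.exists_isSubordinate 𝓘(ℝ, Fin 3 → E4)
    (isClosed_tsupport _) (fun i : {z // z ∈ t} => O i.1 i.1.2) (fun i => hOopen _ _) hsub
  have hφs : ∀ i, ContDiff ℝ ∞ (fun x => ((φ i x : ℝ) : ℂ)) := fun i =>
    Complex.ofRealCLM.contDiff.comp (contMDiff_iff_contDiff.1 (φ i).contMDiff)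
  have hGs : ∀ i, ContDiff ℝ ∞ (fun x => ((φ i x : ℝ) : ℂ) * F x) := fun i => (hφs i).mul (F.smooth _)
  have hGc : ∀ i, HasCompactSupport (fun x => ((φ i x : ℝ) : ℂ) * F x) := fun i => hFc.mul_left
  set G : {z // z ∈ t} → 𝓢((Fin 3 → E4), ℂ) := fun i => (hGc i).toSchwartzMap (hGs i) with hGdef
  have hG_apply : ∀ i x, G i x = ((φ i x : ℝ) : ℂ) * F x := fun i x => rfl
  have hGsupp : ∀ i, tsupport (G i : (Fin 3 → E4) → ℂ) ⊆ O i.1 i.1.2 := by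
    intro i
    refine subset_trans ?_ (hφ i)
    have h1 : tsupport (G i : (Fin 3 → E4) → ℂ) ⊆ tsupport (fun x => ((φ i x : ℝ) : ℂ)) := by
      rw [show ((G i : 𝓢((Fin 3 → E4), ℂ)) : (Fin 3 → E4) → ℂ) = fun x => ((φ i x : ℝ) : ℂ) * F x from
        funext (hG_apply i)]
      exact tsupport_mul_subset_left
    exact h1.trans (tsupport_comp_subset Complex.ofReal_zero _)
  have hGc' : ∀ i, HasCompactSupport (G i : (Fin 3 → E4) → ℂ) := fun i => by
    rw [show ((G i : 𝓢((Fin 3 → E4), ℂ)) : (Fin 3 → E4) → ℂ) = fun x => ((φ i x : ℝ) : ℂ) * F x from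
      funext (hG_apply i)]
    exact hGc i
  have hsum1 : ∀ x ∈ tsupport (F : (Fin 3 → E4) → ℂ), ∑ i, φ i x = 1 := fun x hx => by
    rw [← finsum_eq_sum_of_fintype]
    exact φ.sum_eq_one hx
  have hFsum : ∀ x, F x = ∑ i, G i x := by
    intro x
    simp only [hG_apply, ← Finset.sum_mul]
    by_cases hx : x ∈ tsupport (F : (Fin 3 → E4) → ℂ)
    · rw [← Complex.ofReal_sum, hsum1 x hx, Complex.ofReal_one, one_mul]
    · rw [image_eq_zero_of_notMem_tsupport hx, mul_zero]
  have hFeq : F = ∑ i, G i := by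
    ext x
    rw [hFsum x, sum_apply]
  have hTi : ∀ i, T (G i) = ∫ x, κ x * G i x := fun i => hOrep i.1 i.1.2 (G i) (hGsupp i) (hGc' i)
  calc T F = ∑ i, T (G i) := by rw [hFeq, map_sum]
    _ = ∑ i, ∫ x, κ x * G i x := Finset.sum_congr rfl fun i _ => hTi i
    _ = ∫ x, ∑ i, κ x * G i x := (integral_finsetSum _ fun i _ =>
        hint (G i) (hGc' i) ((hGsupp i).trans (hOΩ _ _))).symm
    _ = ∫ x, κ x * F x := by
        refine integral_congr_ae (Eventually.of_forall fun x => ?_)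
        simp only [← Finset.mul_sum, ← hFsum x]

/-! ## Gluing local kernels on the injective locus -/

/-- **Gluing local kernels.** Let `T` be a continuous functional on `𝓢((ℝ⁴)³, ℂ)` and suppose that at
every injective configuration `y` there is a box of balls `∏ B(yᵢ, ρ)` inside the injective locus and a
kernel continuous on the box representing `T` on the test functions supported in the box, of size
`≤ W y` at the centre. Then `K₃ z :=` (the local kernel at `z`, evaluated at `z`) is continuous on the
injective locus, `‖K₃ y‖ ≤ W y`, and `T F = ∫ K₃ F` for every compactly supported `F` supported in the
injective locus: two continuous local kernels agree on the overlap of their boxes (they represent the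
same functional there), so `K₃` is the local kernel near each point; then `integral_rep_of_local₃`.
[folklore] -/
theorem exists_kernel_of_local₃ (T : 𝓢((Fin 3 → E4), ℂ) →L[ℂ] ℂ) (W : (Fin 3 → E4) → ℝ)
    (hloc : ∀ y : Fin 3 → E4, Function.Injective y → ∃ ρ : ℝ, 0 < ρ ∧ ∃ κ : (Fin 3 → E4) → ℂ,
      ContinuousOn κ {z | ∀ i, z i ∈ ball (y i) ρ} ∧
      {z : Fin 3 → E4 | ∀ i, z i ∈ ball (y i) ρ} ⊆ {z | Function.Injective z} ∧ ‖κ y‖ ≤ W y ∧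
      ∀ F : 𝓢((Fin 3 → E4), ℂ), tsupport (F : (Fin 3 → E4) → ℂ) ⊆ {z | ∀ i, z i ∈ ball (y i) ρ} →
        Integrable (fun z => κ z * F z) ∧ T F = ∫ z, κ z * F z) :
    ∃ K₃ : (Fin 3 → E4) → ℂ, ContinuousOn K₃ {y | Function.Injective y} ∧
      (∀ y : Fin 3 → E4, Function.Injective y → ‖K₃ y‖ ≤ W y) ∧
      ∀ F : 𝓢((Fin 3 → E4), ℂ), HasCompactSupport (F : (Fin 3 → E4) → ℂ) →
        tsupport (F : (Fin 3 → E4) → ℂ) ⊆ {y | Function.Injective y} →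
          Integrable (fun y => K₃ y * F y) ∧ T F = ∫ y, K₃ y * F y := by
  choose ρ hρ κ hκc hκinj hκW hκrep using hloc
  let K₃ : (Fin 3 → E4) → ℂ := fun z => if h : Function.Injective z then κ z h z else 0
  -- two local kernels agree on the overlap of their boxes
  have hagree : ∀ (y : Fin 3 → E4) (hy : Function.Injective y),
      ∀ z ∈ {z : Fin 3 → E4 | ∀ i, z i ∈ ball (y i) (ρ y hy)}, K₃ z = κ y hy z := by
    intro y hy z hz
    have hz' : Function.Injective z := hκinj y hy hz
    simp only [K₃, dif_pos hz']
    set O : Set (Fin 3 → E4) := {u | ∀ i, u i ∈ ball (y i) (ρ y hy)} ∩ {u | ∀ i, u i ∈ ball (z i) (ρ z hz')}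
      with hO
    have hOopen : IsOpen O := (isOpen_box y _).inter (isOpen_box z _)
    have hzO : z ∈ O := ⟨hz, fun i => mem_ball_self (hρ z hz')⟩
    have heq := eqOn_of_forall_integral_mul_eq hOopen ((hκc z hz').mono inter_subset_right)
      ((hκc y hy).mono inter_subset_left) (fun F hF _ => by
        rw [← (hκrep z hz' F (hF.trans inter_subset_right)).2, ← (hκrep y hy F (hF.trans inter_subset_left)).2])
    exact heq hzO
  have hK₃cont : ContinuousOn K₃ {y | Function.Injective y} := by
    intro y hy
    have hy' : Function.Injective y := hy
    have hmem : {z : Fin 3 → E4 | ∀ i, z i ∈ ball (y i) (ρ y hy')} ∈ 𝓝 y :=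
      (isOpen_box y _).mem_nhds fun i => mem_ball_self (hρ y hy')
    have h1 : ContinuousAt (κ y hy') y := (hκc y hy').continuousAt hmem
    have h2 : K₃ =ᶠ[𝓝 y] κ y hy' := by
      filter_upwards [hmem] with z hz
      exact hagree y hy' z hz
    exact (h1.congr_of_eventuallyEq h2).continuousWithinAt
  refine ⟨K₃, hK₃cont, fun y hy => ?_, fun F hFc hF => ?_⟩
  · have h : K₃ y = κ y hy y := by simp only [K₃, dif_pos hy]
    rw [h]
    exact hκW y hy
  · refine integral_rep_of_local₃ T isOpen_setOf_injective K₃ hK₃cont (fun z hz => ?_) F hFc hF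
    have hz' : Function.Injective z := hz
    refine ⟨{u | ∀ i, u i ∈ ball (z i) (ρ z hz')}, isOpen_box z _, fun i => mem_ball_self (hρ z hz'),
      hκinj z hz', fun G hG _ => ?_⟩
    rw [(hκrep z hz' G hG).2]
    refine integral_congr_ae (Eventually.of_forall fun u => ?_)
    by_cases hu : u ∈ tsupport (G : (Fin 3 → E4) → ℂ)
    · show κ z hz' u * G u = K₃ u * G u
      rw [hagree z hz' u (hG hu)]
    · show κ z hz' u * G u = K₃ u * G u
      rw [image_eq_zero_of_notMem_tsupport hu, mul_zero, mul_zero]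

/-! ## Tensors with factors supported in disjoint balls -/

/-- Test functions supported in a ball have compact support. [folklore] -/
theorem hasCompactSupport_of_tsupport_subset_ball {f : 𝓢(E4, ℂ)} {x : E4} {r : ℝ}
    (h : tsupport (f : E4 → ℂ) ⊆ ball x r) : HasCompactSupport (f : E4 → ℂ) :=
  IsCompact.of_isClosed_subset (isCompact_closedBall x r) (isClosed_tsupport _) (h.trans ball_subset_closedBall)

/-- Replacing one factor by its iterated line derivative does not enlarge the factor supports. [folklore] -/
theorem tsupport_update_iterate_subset (f : Fin 3 → 𝓢(E4, ℂ)) (k : Fin 3) (t : E4) (N : ℕ) (i : Fin 3) :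
    tsupport ((Function.update f k ((LineDeriv.lineDerivOp t : 𝓢(E4, ℂ) → 𝓢(E4, ℂ))^[N] (f k)) i : 𝓢(E4, ℂ)) :
      E4 → ℂ) ⊆ tsupport (f i : E4 → ℂ) := by
  by_cases hi : i = k
  · subst hi
    rw [Function.update_self]
    exact CurvatureKernel.tsupport_iterate_lineDerivOp_subset t N (f i)
  · rw [Function.update_of_ne hi]

/-- **A tensor with factors supported in disjoint balls lies in `⁰𝒮₃`.** If `2r < dist (xᵢ, xⱼ)` for
`i ≠ j`, `supp gᵢ ⊆ B(xᵢ, r)` and `F = ⊗ᵢ gᵢ`, then `supp F` lies in the injective locus, so `F ∈ ⁰𝒮₃`.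
[folklore] -/
theorem tsupport_subset_injective_of_isTensorOf {x : Fin 3 → E4} {r : ℝ}
    (hsep : ∀ i j, i ≠ j → 2 * r < dist (x i) (x j)) {g : Fin 3 → 𝓢(E4, ℂ)}
    (hg : ∀ i, tsupport (g i : E4 → ℂ) ⊆ ball (x i) r) {F : 𝓢((Fin 3 → E4), ℂ)} (hF : IsTensorOf F g) :
    tsupport (F : (Fin 3 → E4) → ℂ) ⊆ {y | Function.Injective y} := fun _ hy =>
  injective_of_mem_box (fun i j hij => (hsep i j hij).le) fun i => hg i (hF.tsupport_subset hy i)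

/-- The `⁰𝒮₃` form of `tsupport_subset_injective_of_isTensorOf`. [folklore] -/
theorem isOffDiagonal_of_isTensorOf_ball {x : Fin 3 → E4} {r : ℝ}
    (hsep : ∀ i j, i ≠ j → 2 * r < dist (x i) (x j)) {g : Fin 3 → 𝓢(E4, ℂ)}
    (hg : ∀ i, tsupport (g i : E4 → ℂ) ⊆ ball (x i) r) {F : 𝓢((Fin 3 → E4), ℂ)} (hF : IsTensorOf F g) :
    IsOffDiagonal F :=
  isOffDiagonal_of_tsupport_subset_injective (tsupport_subset_injective_of_isTensorOf hsep hg hF)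

/-! ## Moving a slot to the last position -/

/-- The transposition `(k 2)` moves slot `k` last; its values at `0, 1` are the two other slots. [folklore] -/
theorem swap_fin_three_ne (k : Fin 3) :
    Equiv.swap k 2 0 ≠ k ∧ Equiv.swap k 2 1 ≠ k ∧ Equiv.swap k 2 0 ≠ Equiv.swap k 2 1 := by
  refine ⟨fun h => ?_, fun h => ?_, fun h => ?_⟩
  · have h' : Equiv.swap k 2 0 = Equiv.swap k 2 2 := by rw [h, Equiv.swap_apply_right]
    exact absurd ((Equiv.swap k 2).injective h') (by decide)
  · have h' : Equiv.swap k 2 1 = Equiv.swap k 2 2 := by rw [h, Equiv.swap_apply_right]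
    exact absurd ((Equiv.swap k 2).injective h') (by decide)
  · exact absurd ((Equiv.swap k 2).injective h) (by decide)

/-- Composing a three-slot family updated at slot `k` with the transposition `(k 2)` puts the updated
entry last: `(update f k g) ∘ (k 2) = (f_{(k 2) 0}, f_{(k 2) 1}, g)`. [folklore] -/
theorem update_comp_swap {α : Type*} (f : Fin 3 → α) (k : Fin 3) (g : α) :
    Function.update f k g ∘ (Equiv.swap k 2) = ![f (Equiv.swap k 2 0), f (Equiv.swap k 2 1), g] := by
  obtain ⟨h0, h1, -⟩ := swap_fin_three_ne k
  funext i
  fin_cases i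
  · simp [Function.update_of_ne h0]
  · simp [Function.update_of_ne h1]
  · simp

/-- A permuted tensor: if `F = ⊗ (update f k g)` then `F ∘ (· ∘ (k 2))` is the tensor
`f_{(k 2) 0} ⊗ f_{(k 2) 1} ⊗ g`. [folklore] -/
theorem isTensorOf_permTest_swap {f : Fin 3 → 𝓢(E4, ℂ)} {k : Fin 3} {g : 𝓢(E4, ℂ)}
    {F : 𝓢((Fin 3 → E4), ℂ)} (hF : IsTensorOf F (Function.update f k g)) :
    IsTensorOf (permTest (Equiv.swap k 2) F) ![f (Equiv.swap k 2 0), f (Equiv.swap k 2 1), g] := by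
  have h := hF.permTest (Equiv.swap k 2)
  rwa [Equiv.symm_swap, update_comp_swap] at h

/-- The product of three slot quantities, reindexed by the transposition `(k 2)`. [folklore] -/
theorem prod_eq_swap_mul (φ : Fin 3 → ℝ) (k : Fin 3) :
    ∏ i, φ i = φ (Equiv.swap k 2 0) * φ (Equiv.swap k 2 1) * φ k := by
  rw [← Fintype.prod_equiv (Equiv.swap k 2) (φ ∘ Equiv.swap k 2) φ (fun _ => rfl), Fin.prod_univ_three]
  simp only [Function.comp_apply, Equiv.swap_apply_right]

end ThreePointKernel

end Summit.QuantumFields.YangMills.Theorems.TemperedCurvatureMoments.Sketch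

end
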